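import Summits.QuantumFields.YangMills.Theorems.FluctuationComparisonRegPrIntLS2BetaTreeCombBondStep
import Summits.QuantumFields.YangMills.Theorems.FluctuationComparisonRegPrIntLS2BetaWhitneyHatLiftRelativeSup
import Summits.QuantumFields.YangMills.Theorems.FluctuationComparisonRegPrIntLS2BetaSmallBondGaugeToronObstruction
import Summits.QuantumFields.YangMills.Theorems.FluctuationComparisonRegPrIntLS2BetaResidualGauge
import HarnessLib

/-!
# S2β · THE SUP CHAIN, (LIFT-LAD′) — THE COMB ROW OF THE LIFT RECURSION FOR THE RAW DESCENDED PAIR, PER BOND: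
# on a tree-comb bond the level-`j` relative log of the pair `(M^jU, M^jU₀)` is `≤ c_lift·L⁻¹ ×` the largest level-`(j+1)` relative log on its hat feeders

Cell `ym3-torus` (YM ladder rung R3 = continuum `SU(2)` Yang–Mills on the three-torus at fixed lattice data — a RUNG: NOT d = 4, NOT infinite volume,
NOT a mass gap, NOT Clay).  Width seat «width 12» `ym3-torus-px12` (gen 26), FREE px helper on crux `stmt-QuantumFields-20520`
(`…Theses.UnitScaleTilt.FluctuationComparisonRegPrIntL`), LINE g18-1 S2β, the pairing lane's sup chain (UV3-NODE §94.5): (ST) ⟸ {(TOP-LAD), (LIFT-LAD),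
(SCT-c)} (px17 g22 ✓`…S2BetaSupTowerOfLiftLadder` ∕ `…Split`; READ′ re-cut ✓`…S2BetaReadNesting`, px10 g25).  THIS FILE is the px12 lineage's row of
(LIFT-LAD′): the COMB part of `a_{t+1} ≤ A·a_t + c_{t+1}` with `A = (c_lift∕L)²`, BY KERNEL, in the generic one-`Params` internal-tower currency of
✓`…S2BetaTreeCombBondStep` ∕ ✓`…S2BetaStageAxialCombReading` (the `descendTo`∕READ′ docking into FILE 3′'s `E′` binder is a separate file).
`--kind proof --supports stmt-QuantumFields-20520 --as helper`, count-neutral, DEFINITION-FREE (0 `def`, 0 `instance`, 0 `notation`, 0 `sorry`, default heartbeats).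

THE SITUATION.  `AxStage` (✓`…S2BetaStageAxialLetters.axStage_exists`) supplies hat weights `wt`, the geodesic hat lift `lift`, a fibre mate `U₁` and two stage gauge
towers `g` (for `U`) and `g₀` (for `U₁`) with `U₀ = (g_0⁻¹·g₀_0) • U₁`; (T3) `M^j(g_0 • X) = g_j • M^jX`; (T4) the comb transports of `U′_j := g_j • M^jU` are those of
`V_j := lift_j U′_{j+1}` (same for `U₁′_j := g₀_j • M^jU₁`).  The (ST) summands read the RAW descended pair `(M^jU, M^jU₀)`.
* §1 THE GAUGE MOVE ([folklore] group algebra over (T3)×2): `M^jU = g_j⁻¹ • U′_j`, `M^jU₀ = g_j⁻¹ • U₁′_j` (`iter_gaugeAct_inv_of_T3`, `iter_eq_of_bottom`), so the raw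
  chord is the `g_j(b₋)⁻¹`-CONJUGATE of the stage chord (`rawChord_eq_conj_stageChord`) and ★`norm_logVec_rawChord_eq_stageChord`: their arcs AGREE at every level.
* §2 ★★★ THE COMB ROW PER BOND (`norm_logVec_rawChord_treeComb_le`): on a tree-comb bond `⟨x, μ⟩` of level `j` (✓p828327's `hblk ∧ hlo`), if the two level-`(j+1)`
  STAGE fields have arcs `≤ σ` (`σ² ≤ 3`) on the hat feeders of `⟨x,μ⟩` (the lane's sup-profile letters — HYPOTHESES here, exactly as in (R1)-sup) and the RAW
  level-`(j+1)` relative logs are `≤ m` there, then the RAW level-`j` relative log at `⟨x,μ⟩` is `≤ (π∕2)(1+σ²∕3)·L⁻¹·m` — §1 at level `j` ∘ ✓`stageChord_treeComb_eq_liftChord`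
  ∘ ✓p829341 `norm_logVec_lift_rel_le_of_logVec` ∘ §1 at level `j+1`.  ★★`…_sharp`: the fine relative arc is a priori `≤ 2·L⁻¹·σ` (✓`arc_lift_le` ×2), so
  ✓`norm_logVec_lift_rel_le_of_arc` replaces Jordan's `π∕2` by `(1 + (2L⁻¹σ)²∕3)`: **`c_lift(σ, L) = (1 + (2L⁻¹σ)²∕3)·(1 + σ²∕3) → 1`**; ★`…_le_eleven_tenths`: `σ ≤ 1∕4`,
  `2 ≤ L` ⟹ `c_lift ≤ 11∕10` (so `A·L = (11∕10)²∕L = 0.403…` at `L = 3`, `0.242` at `L = 5` — inside ✓p830137's `A·L ≤ ½`).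
* §3 THE TRUNCATED PI-SUP FORMS ([folklore] `pi_norm_le_iff_of_nonneg`): ★★`pi_norm_trunc_le_of_row` — for ANY bond predicates `pS` (fine) ∕ `pT` (coarse) such that
  every `pS`-bond obeys a per-bond row with constant `c` over its feeders and has all its feeders in `pT`, `‖𝟙_{pS}·f‖ ≤ c·‖𝟙_{pT}·f′‖` and the squared edition;
  ★`sq_pi_norm_trunc_le_add` — the comb∕non-comb SPLIT `‖𝟙_p·f‖² ≤ ‖𝟙_{p∧q}·f‖² + ‖𝟙_{p∧¬q}·f‖²`.  FILE 3′'s `E′` summands instantiate `pS := READ′_{t+1}(B) ∧ comb`,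
  `pT := READ′_t(B)` (feeders nest PER `B`: ✓p830803 `natAbs_rel_blockOf_src_le_two`).

INHABITATION (★★OWNER RULING №100): LAW-FREE — group algebra, the hat lift's log-linearity, torus bookkeeping; no fibre law, no score, no integrability.

HONEST SCOPE.  Compositions of landed letters by name; nothing of Bałaban's renormalisation-group analysis is asserted or proved ([Balaban1985RegularSpaces] (1.19) p.79,
(1.29) p.81 — the printed one-level axial gauge and the `L⁻¹` regularity of `Q*`-type lifts; [Balaban1985Averaging] Prop. 4 (128)–(135) pp.37–38 — the printed sup recursion
this row transcribes; [Balaban1985Variational] (16)–(18) p.280).  The arc bounds `σ`, (TOP-LAD′), the non-comb rows (SCT′₁₂₃), (ST′)∕(ST), LOC, AVG₂♭-ax_q, (D-ax), `h3`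
are HYPOTHESES of the lane; GAP♯∘ (`stub_uniformFibreGapOrbit`, registry 3732b7df UNTOUCHED), the five registered stubs (0∕5), S2β, 20520, 19936, 19200,
`YM3TorusSU2` are NOT proved; no registered stub is closed; rung R3 — NOT d = 4, NOT infinite volume, NOT a mass gap, NOT Clay; the Yang–Mills mass gap is NOT proved.
-/

set_option autoImplicit false

namespace Summit.QuantumFields.YangMills.Theorems.FluctuationComparisonRegPrIntLS2BetaLiftLadderCombRow

open Finset
open scoped Real
open Literature.MathematicalPhysics.QuantumLattice (su2Quat)
open Literature.MathematicalPhysics.QuantumFieldTheory.Balaban1983to89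
open T4Continuum
open B10Eq27TorusAxialLog (rel axialT)
open T4CubeChartGnomonic (SU2)
open T4HaarSU2ExpChart (expPoint)
open T4ExpWindowSmallField (logVec expPoint_logVec)
open Summit.QuantumFields.YangMills.Theorems.FluctuationComparisonRegPrIntLS2BetaResidualGauge (gaugeAct_mul_eq gaugeAct_inv_gaugeAct gaugeAct_gaugeAct_inv)
open Summit.QuantumFields.YangMills.Theorems.FluctuationComparisonRegPrIntLS2BetaTreeCombBondStep (stageChord_treeComb_eq_liftChord)
open Summit.QuantumFields.YangMills.Theorems.FluctuationComparisonRegPrIntLS2BetaWhitneyHatLiftRelativeSup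
  (norm_logVec_lift_rel_le_of_logVec norm_logVec_lift_rel_le_of_arc)
open Summit.QuantumFields.YangMills.Theorems.FluctuationComparisonRegPrIntLS2BetaWhitneyHatLift (arc_lift_le)
open Summit.QuantumFields.YangMills.Theorems.FluctuationComparisonRegPrIntLS2BetaSmallBondGaugeToronObstruction
  (norm_logVec_su2Quat_conj norm_logVec_su2Quat_eq_arccos_reTr)
open Summit.QuantumFields.YangMills.Theorems.FluctuationComparisonRegPrIntLS2BetaGeodesicJensenLift (dist1_le_norm_logVec)

variable {P : Params}

/-! ## §1 The gauge move: the raw descended pair is the common `g_j⁻¹`-transform of the two stage-tower fields -/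

section GaugeMove

variable {G : Type*} [GaugeGroup G]

/-- **(T3) INVERTED**: `M^j(g_0 • X) = g_j • M^jX` for all `X` ⟹ `M^j(g_0⁻¹ • Y) = g_j⁻¹ • M^jY` for all `Y`. [folklore] -/
theorem iter_gaugeAct_inv_of_T3 (av : ∀ i, Averaging P i G) (g : (i : ℕ) → Site P i → G) {j : ℕ}
    (hT3 : ∀ X : GaugeField P 0 G, Averaging.iter av j (GaugeField.gaugeAct (g 0) X) = GaugeField.gaugeAct (g j) (Averaging.iter av j X))
    (Y : GaugeField P 0 G) :
    Averaging.iter av j (GaugeField.gaugeAct (fun x => (g 0 x)⁻¹) Y) = GaugeField.gaugeAct (fun x => (g j x)⁻¹) (Averaging.iter av j Y) := by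
  have h := hT3 (GaugeField.gaugeAct (fun x => (g 0 x)⁻¹) Y)
  have e1 : GaugeField.gaugeAct (g 0) (GaugeField.gaugeAct (fun x => (g 0 x)⁻¹) Y) = Y := gaugeAct_gaugeAct_inv (g 0) Y
  rw [e1] at h
  calc Averaging.iter av j (GaugeField.gaugeAct (fun x => (g 0 x)⁻¹) Y)
      = GaugeField.gaugeAct (fun x => (g j x)⁻¹) (GaugeField.gaugeAct (g j) (Averaging.iter av j (GaugeField.gaugeAct (fun x => (g 0 x)⁻¹) Y))) :=
        (gaugeAct_inv_gaugeAct (g j) _).symm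
    _ = GaugeField.gaugeAct (fun x => (g j x)⁻¹) (Averaging.iter av j Y) := by rw [← h]

/-- **THE FIRST TOWER**: `M^jU = g_j⁻¹ • U′_j` with `U′_j := g_j • M^jU`. [folklore] -/
theorem iter_eq_gaugeAct_inv_stage (av : ∀ i, Averaging P i G) (g : (i : ℕ) → Site P i → G) {j : ℕ} (U : GaugeField P 0 G) :
    Averaging.iter av j U = GaugeField.gaugeAct (fun x => (g j x)⁻¹) (GaugeField.gaugeAct (g j) (Averaging.iter av j U)) :=
  (gaugeAct_inv_gaugeAct (g j) _).symm

/-- **THE SECOND TOWER READ FROM THE BOTTOM RELATION**: `U₀ = (g_0⁻¹·g₀_0) • U₁`, (T3) for `g` and for `g₀` ⟹ `M^jU₀ = g_j⁻¹ • (g₀_j • M^jU₁) = g_j⁻¹ • U₁′_j`.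
[cite: Balaban1985Averaging, (8), (11) p.19; Balaban1985Variational, (3)-(4) p.278] -/
theorem iter_eq_of_bottom (av : ∀ i, Averaging P i G) (g g₀ : (i : ℕ) → Site P i → G) {j : ℕ} (U₁ U₀ : GaugeField P 0 G)
    (hT3 : ∀ X : GaugeField P 0 G, Averaging.iter av j (GaugeField.gaugeAct (g 0) X) = GaugeField.gaugeAct (g j) (Averaging.iter av j X))
    (hT3' : ∀ X : GaugeField P 0 G, Averaging.iter av j (GaugeField.gaugeAct (g₀ 0) X) = GaugeField.gaugeAct (g₀ j) (Averaging.iter av j X))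
    (hU₀ : U₀ = GaugeField.gaugeAct (fun x => (g 0 x)⁻¹ * g₀ 0 x) U₁) :
    Averaging.iter av j U₀ = GaugeField.gaugeAct (fun x => (g j x)⁻¹) (GaugeField.gaugeAct (g₀ j) (Averaging.iter av j U₁)) := by
  have e1 : GaugeField.gaugeAct (fun x => (g 0 x)⁻¹ * g₀ 0 x) U₁ = GaugeField.gaugeAct (fun x => (g 0 x)⁻¹) (GaugeField.gaugeAct (g₀ 0) U₁) :=
    gaugeAct_mul_eq (fun x => (g 0 x)⁻¹) (g₀ 0) U₁
  rw [hU₀, e1, iter_gaugeAct_inv_of_T3 av g hT3, hT3']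

/-- **CHORDS OF A COMMONLY GAUGED PAIR ARE CONJUGATES**: `(h•A) b·((h•B) b)⁻¹ = h(b₋)·(A b·(B b)⁻¹)·h(b₋)⁻¹`. [cite: Balaban1985Averaging, (8) p.19] -/
theorem chord_gaugeAct_eq_conj {j : ℕ} (h : Site P j → G) (A B : GaugeField P j G) (b : PBond P j) :
    GaugeField.gaugeAct h A b * (GaugeField.gaugeAct h B b)⁻¹ = h b.src * (A b * (B b)⁻¹) * (h b.src)⁻¹ := by
  simp only [GaugeField.gaugeAct, mul_inv_rev, inv_inv]
  group

/-- ★ **THE RAW CHORD IS A CONJUGATE OF THE STAGE CHORD**: `M^jU b·(M^jU₀ b)⁻¹ = g_j(b₋)⁻¹·(U′_j b·(U₁′_j b)⁻¹)·(g_j(b₋)⁻¹)⁻¹`.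
[cite: Balaban1985Averaging, (8), (11) p.19; Balaban1985Variational, (3)-(4) p.278] -/
theorem rawChord_eq_conj_stageChord (av : ∀ i, Averaging P i G) (g g₀ : (i : ℕ) → Site P i → G) {j : ℕ} (U U₁ U₀ : GaugeField P 0 G)
    (hT3 : ∀ X : GaugeField P 0 G, Averaging.iter av j (GaugeField.gaugeAct (g 0) X) = GaugeField.gaugeAct (g j) (Averaging.iter av j X))
    (hT3' : ∀ X : GaugeField P 0 G, Averaging.iter av j (GaugeField.gaugeAct (g₀ 0) X) = GaugeField.gaugeAct (g₀ j) (Averaging.iter av j X))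
    (hU₀ : U₀ = GaugeField.gaugeAct (fun x => (g 0 x)⁻¹ * g₀ 0 x) U₁) (b : PBond P j) :
    Averaging.iter av j U b * (Averaging.iter av j U₀ b)⁻¹ =
      (g j b.src)⁻¹ * (GaugeField.gaugeAct (g j) (Averaging.iter av j U) b * (GaugeField.gaugeAct (g₀ j) (Averaging.iter av j U₁) b)⁻¹) * ((g j b.src)⁻¹)⁻¹ := by
  conv_lhs => rw [iter_eq_gaugeAct_inv_stage av g U, iter_eq_of_bottom av g g₀ U₁ U₀ hT3 hT3' hU₀]
  exact chord_gaugeAct_eq_conj (fun x => (g j x)⁻¹) _ _ b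

end GaugeMove

/-! ## §1 (continued, `SU(2)`): the arcs of the raw and the stage chords agree -/

section Arcs

/-- ★ **THE RAW RELATIVE LOG IS THE STAGE RELATIVE LOG** at every level `j` (arc is a class function: ✓`norm_logVec_su2Quat_conj`).
[cite: Balaban1985Averaging, (8), (11) p.19; Balaban1985Variational, (3)-(4) p.278] -/
theorem norm_logVec_rawChord_eq_stageChord (av : ∀ i, Averaging P i SU2) (g g₀ : (i : ℕ) → Site P i → SU2) {j : ℕ} (U U₁ U₀ : GaugeField P 0 SU2)
    (hT3 : ∀ X : GaugeField P 0 SU2, Averaging.iter av j (GaugeField.gaugeAct (g 0) X) = GaugeField.gaugeAct (g j) (Averaging.iter av j X))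
    (hT3' : ∀ X : GaugeField P 0 SU2, Averaging.iter av j (GaugeField.gaugeAct (g₀ 0) X) = GaugeField.gaugeAct (g₀ j) (Averaging.iter av j X))
    (hU₀ : U₀ = GaugeField.gaugeAct (fun x => (g 0 x)⁻¹ * g₀ 0 x) U₁) (b : PBond P j) :
    ‖logVec (su2Quat (Averaging.iter av j U b * (Averaging.iter av j U₀ b)⁻¹))‖ =
      ‖logVec (su2Quat (GaugeField.gaugeAct (g j) (Averaging.iter av j U) b * (GaugeField.gaugeAct (g₀ j) (Averaging.iter av j U₁) b)⁻¹))‖ := by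
  rw [rawChord_eq_conj_stageChord av g g₀ U U₁ U₀ hT3 hT3' hU₀ b]
  exact norm_logVec_su2Quat_conj _ _

/-- The arc is invariant under inversion: `arc X⁻¹ = arc X`. [folklore] -/
theorem norm_logVec_su2Quat_inv (X : SU2) : ‖logVec (su2Quat X⁻¹)‖ = ‖logVec (su2Quat X)‖ := by
  rw [norm_logVec_su2Quat_eq_arccos_reTr, norm_logVec_su2Quat_eq_arccos_reTr, GaugeGroup.reTr_inv]

/-- The relative arc of two bond variables is at most the sum of their arcs: `arc (X·Y⁻¹) ≤ arc X + arc Y`. [folklore] -/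
theorem norm_logVec_mul_inv_le_add (X Y : SU2) :
    ‖logVec (su2Quat (X * Y⁻¹))‖ ≤ ‖logVec (su2Quat X)‖ + ‖logVec (su2Quat Y)‖ := by
  have h := FluctuationComparisonRegPrIntLS2BetaArcBondSplit.norm_logVec_su2Quat_mul_le X Y⁻¹
  rwa [norm_logVec_su2Quat_inv] at h

end Arcs

/-! ## §2 The comb row per bond -/

section CombRow

/-- ★★★ **(LIFT-LAD′), THE COMB ROW PER BOND, FOR THE RAW DESCENDED PAIR** (Jordan edition).  One `Params`, levels `j` (fine) and `j+1` (coarse), standing range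
`j + 1 ≤ m + K`; the `AxStage` witness data `(wt, lift, g, g₀, U₁)` with the hat-weight ∕ hat-lift formulas at level `j`, (T3) for both towers at levels `j` and `j+1`,
the bottom relation `U₀ = (g_0⁻¹·g₀_0) • U₁`, and (T4) for both towers at stage `j`.  On a TREE-COMB bond `⟨x, μ⟩` (`blockOf (x+e_μ) = blockOf x`, `(x − emb(blockOf x))_ν = 0`
for `ν < μ`): if the two level-`(j+1)` STAGE fields have arcs `≤ σ` (`σ² ≤ 3`) on the hat feeders of `⟨x,μ⟩` and the RAW level-`(j+1)` relative logs are `≤ m` there, then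
`‖logVec (su2Quat (M^jU ⟨x,μ⟩·(M^jU₀ ⟨x,μ⟩)⁻¹))‖ ≤ (π∕2)·(1 + σ²∕3)·L⁻¹·m`.
[cite: Balaban1985RegularSpaces, (1.19) p.79, (1.29) p.81; Balaban1985Averaging, Prop. 4 (128)-(135) p.37-38; Balaban1985Variational, (16)-(18) p.280] -/
theorem norm_logVec_rawChord_treeComb_le (av : ∀ i, Averaging P i SU2) {j : ℕ} (hj : j + 1 ≤ P.m + P.K)
    (wt : (i : ℕ) → PBond P i → PBond P (i + 1) → ℝ) (lift : (i : ℕ) → GaugeField P (i + 1) SU2 → GaugeField P i SU2)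
    (g g₀ : (i : ℕ) → Site P i → SU2) (U U₁ U₀ : GaugeField P 0 SU2)
    (hwt : ∀ b e, wt j b e = if e.dir = b.dir ∧ (b.src b.dir - emb e.src b.dir).val < P.L then
      ∏ ν ∈ Finset.univ.erase b.dir, max 0 (1 - ((rel (emb e.src) b.src ν).natAbs : ℝ) / P.L) else 0)
    (hlift : ∀ (X : GaugeField P (j + 1) SU2) (b : PBond P j), lift j X b = expPoint (∑ e, wt j b e • ((P.L : ℝ)⁻¹ • logVec (su2Quat (X e)))))
    (hT3 : ∀ X : GaugeField P 0 SU2, Averaging.iter av j (GaugeField.gaugeAct (g 0) X) = GaugeField.gaugeAct (g j) (Averaging.iter av j X))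
    (hT3s : ∀ X : GaugeField P 0 SU2, Averaging.iter av (j + 1) (GaugeField.gaugeAct (g 0) X) = GaugeField.gaugeAct (g (j + 1)) (Averaging.iter av (j + 1) X))
    (hT3' : ∀ X : GaugeField P 0 SU2, Averaging.iter av j (GaugeField.gaugeAct (g₀ 0) X) = GaugeField.gaugeAct (g₀ j) (Averaging.iter av j X))
    (hT3s' : ∀ X : GaugeField P 0 SU2, Averaging.iter av (j + 1) (GaugeField.gaugeAct (g₀ 0) X) = GaugeField.gaugeAct (g₀ (j + 1)) (Averaging.iter av (j + 1) X))
    (hU₀ : U₀ = GaugeField.gaugeAct (fun x => (g 0 x)⁻¹ * g₀ 0 x) U₁)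
    (hT4 : ∀ x, axialT (GaugeField.gaugeAct (g j) (Averaging.iter av j U)) (emb (blockOf x)) x =
      axialT (lift j (GaugeField.gaugeAct (g (j + 1)) (Averaging.iter av (j + 1) U))) (emb (blockOf x)) x)
    (hT4' : ∀ x, axialT (GaugeField.gaugeAct (g₀ j) (Averaging.iter av j U₁)) (emb (blockOf x)) x =
      axialT (lift j (GaugeField.gaugeAct (g₀ (j + 1)) (Averaging.iter av (j + 1) U₁))) (emb (blockOf x)) x)
    (x : Site P j) (μ : Fin P.d) (hblk : blockOf (x.shift μ) = blockOf x) (hlo : ∀ ν, ν < μ → rel (emb (blockOf x)) x ν = 0)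
    {σ m : ℝ}
    (hσ : ∀ e, wt j ⟨x, μ⟩ e ≠ 0 → ‖logVec (su2Quat (GaugeField.gaugeAct (g (j + 1)) (Averaging.iter av (j + 1) U) e))‖ ≤ σ)
    (hσ' : ∀ e, wt j ⟨x, μ⟩ e ≠ 0 → ‖logVec (su2Quat (GaugeField.gaugeAct (g₀ (j + 1)) (Averaging.iter av (j + 1) U₁) e))‖ ≤ σ)
    (hσ3 : σ ^ 2 ≤ 3)
    (hm : ∀ e, wt j ⟨x, μ⟩ e ≠ 0 → ‖logVec (su2Quat (Averaging.iter av (j + 1) U e * (Averaging.iter av (j + 1) U₀ e)⁻¹))‖ ≤ m) :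
    ‖logVec (su2Quat (Averaging.iter av j U ⟨x, μ⟩ * (Averaging.iter av j U₀ ⟨x, μ⟩)⁻¹))‖ ≤ π / 2 * ((1 + σ ^ 2 / 3) * ((P.L : ℝ)⁻¹ * m)) := by
  rw [norm_logVec_rawChord_eq_stageChord av g g₀ U U₁ U₀ hT3 hT3' hU₀ ⟨x, μ⟩,
    stageChord_treeComb_eq_liftChord av hj lift g g₀ U U₁ hT4 hT4' x μ hblk hlo]
  refine norm_logVec_lift_rel_le_of_logVec hj (wt j) hwt
    (GaugeField.gaugeAct (g (j + 1)) (Averaging.iter av (j + 1) U)) (GaugeField.gaugeAct (g₀ (j + 1)) (Averaging.iter av (j + 1) U₁))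
    (lift j (GaugeField.gaugeAct (g (j + 1)) (Averaging.iter av (j + 1) U))) (lift j (GaugeField.gaugeAct (g₀ (j + 1)) (Averaging.iter av (j + 1) U₁)))
    (fun b => hlift _ b) (fun b => hlift _ b) ⟨x, μ⟩ hσ hσ' hσ3 fun e he => ?_
  rw [← norm_logVec_rawChord_eq_stageChord av g g₀ U U₁ U₀ hT3s hT3s' hU₀ e]
  exact hm e he

/-- ★★ **(LIFT-LAD′), THE COMB ROW PER BOND — SHARP CONSTANT**: under the same data the fine relative arc is a priori `≤ 2·L⁻¹·σ` (✓`arc_lift_le` on both lifts), so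
✓`norm_logVec_lift_rel_le_of_arc` gives `‖logVec (su2Quat (M^jU ⟨x,μ⟩·(M^jU₀ ⟨x,μ⟩)⁻¹))‖ ≤ (1 + (2L⁻¹σ)²∕3)·(1 + σ²∕3)·L⁻¹·m` for `σ² ≤ 3∕4` — the constant
`c_lift(σ, L) = (1 + (2L⁻¹σ)²∕3)(1 + σ²∕3)` tends to `1` in the small field.
[cite: Balaban1985RegularSpaces, (1.19) p.79, (1.29) p.81; Balaban1985Averaging, Prop. 4 (128)-(135) p.37-38] -/
theorem norm_logVec_rawChord_treeComb_le_sharp (av : ∀ i, Averaging P i SU2) {j : ℕ} (hj : j + 1 ≤ P.m + P.K)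
    (wt : (i : ℕ) → PBond P i → PBond P (i + 1) → ℝ) (lift : (i : ℕ) → GaugeField P (i + 1) SU2 → GaugeField P i SU2)
    (g g₀ : (i : ℕ) → Site P i → SU2) (U U₁ U₀ : GaugeField P 0 SU2)
    (hwt : ∀ b e, wt j b e = if e.dir = b.dir ∧ (b.src b.dir - emb e.src b.dir).val < P.L then
      ∏ ν ∈ Finset.univ.erase b.dir, max 0 (1 - ((rel (emb e.src) b.src ν).natAbs : ℝ) / P.L) else 0)
    (hlift : ∀ (X : GaugeField P (j + 1) SU2) (b : PBond P j), lift j X b = expPoint (∑ e, wt j b e • ((P.L : ℝ)⁻¹ • logVec (su2Quat (X e)))))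
    (hT3 : ∀ X : GaugeField P 0 SU2, Averaging.iter av j (GaugeField.gaugeAct (g 0) X) = GaugeField.gaugeAct (g j) (Averaging.iter av j X))
    (hT3s : ∀ X : GaugeField P 0 SU2, Averaging.iter av (j + 1) (GaugeField.gaugeAct (g 0) X) = GaugeField.gaugeAct (g (j + 1)) (Averaging.iter av (j + 1) X))
    (hT3' : ∀ X : GaugeField P 0 SU2, Averaging.iter av j (GaugeField.gaugeAct (g₀ 0) X) = GaugeField.gaugeAct (g₀ j) (Averaging.iter av j X))
    (hT3s' : ∀ X : GaugeField P 0 SU2, Averaging.iter av (j + 1) (GaugeField.gaugeAct (g₀ 0) X) = GaugeField.gaugeAct (g₀ (j + 1)) (Averaging.iter av (j + 1) X))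
    (hU₀ : U₀ = GaugeField.gaugeAct (fun x => (g 0 x)⁻¹ * g₀ 0 x) U₁)
    (hT4 : ∀ x, axialT (GaugeField.gaugeAct (g j) (Averaging.iter av j U)) (emb (blockOf x)) x =
      axialT (lift j (GaugeField.gaugeAct (g (j + 1)) (Averaging.iter av (j + 1) U))) (emb (blockOf x)) x)
    (hT4' : ∀ x, axialT (GaugeField.gaugeAct (g₀ j) (Averaging.iter av j U₁)) (emb (blockOf x)) x =
      axialT (lift j (GaugeField.gaugeAct (g₀ (j + 1)) (Averaging.iter av (j + 1) U₁))) (emb (blockOf x)) x)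
    (x : Site P j) (μ : Fin P.d) (hblk : blockOf (x.shift μ) = blockOf x) (hlo : ∀ ν, ν < μ → rel (emb (blockOf x)) x ν = 0)
    {σ m : ℝ}
    (hσ : ∀ e, wt j ⟨x, μ⟩ e ≠ 0 → ‖logVec (su2Quat (GaugeField.gaugeAct (g (j + 1)) (Averaging.iter av (j + 1) U) e))‖ ≤ σ)
    (hσ' : ∀ e, wt j ⟨x, μ⟩ e ≠ 0 → ‖logVec (su2Quat (GaugeField.gaugeAct (g₀ (j + 1)) (Averaging.iter av (j + 1) U₁) e))‖ ≤ σ)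
    (hσ34 : σ ^ 2 ≤ 3 / 4)
    (hm : ∀ e, wt j ⟨x, μ⟩ e ≠ 0 → ‖logVec (su2Quat (Averaging.iter av (j + 1) U e * (Averaging.iter av (j + 1) U₀ e)⁻¹))‖ ≤ m) :
    ‖logVec (su2Quat (Averaging.iter av j U ⟨x, μ⟩ * (Averaging.iter av j U₀ ⟨x, μ⟩)⁻¹))‖ ≤
      (1 + (2 * ((P.L : ℝ)⁻¹ * σ)) ^ 2 / 3) * ((1 + σ ^ 2 / 3) * ((P.L : ℝ)⁻¹ * m)) := by
  -- names for the two coarse stage fields and their lifts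
  set X : GaugeField P (j + 1) SU2 := GaugeField.gaugeAct (g (j + 1)) (Averaging.iter av (j + 1) U) with hX
  set X' : GaugeField P (j + 1) SU2 := GaugeField.gaugeAct (g₀ (j + 1)) (Averaging.iter av (j + 1) U₁) with hX'
  have hσ3 : σ ^ 2 ≤ 3 := hσ34.trans (by norm_num)
  rw [norm_logVec_rawChord_eq_stageChord av g g₀ U U₁ U₀ hT3 hT3' hU₀ ⟨x, μ⟩,
    stageChord_treeComb_eq_liftChord av hj lift g g₀ U U₁ hT4 hT4' x μ hblk hlo]
  -- the coarse relative chords in `dist1` currency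
  have hmd : ∀ e, wt j ⟨x, μ⟩ e ≠ 0 → dist1 (X e * (X' e)⁻¹) ≤ m := fun e he => by
    refine (dist1_le_norm_logVec _).trans ?_
    rw [hX, hX', ← norm_logVec_rawChord_eq_stageChord av g g₀ U U₁ U₀ hT3s hT3s' hU₀ e]
    exact hm e he
  -- the a priori fine relative arc: `≤ 2·L⁻¹·σ`
  have hV := arc_lift_le hj (wt j) hwt X (lift j X) (fun b => hlift _ b) ⟨x, μ⟩ hσ
  have hV' := arc_lift_le hj (wt j) hwt X' (lift j X') (fun b => hlift _ b) ⟨x, μ⟩ hσ'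
  have hfine : ‖logVec (su2Quat (lift j X ⟨x, μ⟩ * (lift j X' ⟨x, μ⟩)⁻¹))‖ ≤ 2 * ((P.L : ℝ)⁻¹ * σ) := by
    have h := norm_logVec_mul_inv_le_add (lift j X ⟨x, μ⟩) (lift j X' ⟨x, μ⟩)
    linarith
  have hL1 : (P.L : ℝ)⁻¹ ≤ 1 := by
    have hL : (1 : ℝ) ≤ (P.L : ℝ) := by exact_mod_cast P.hL.2.le
    exact inv_le_one_of_one_le₀ hL
  have hL0 : 0 ≤ (P.L : ℝ)⁻¹ := inv_nonneg.mpr (Nat.cast_nonneg _)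
  have hfine3 : (2 * ((P.L : ℝ)⁻¹ * σ)) ^ 2 ≤ 3 := by
    have h1 : ((P.L : ℝ)⁻¹) ^ 2 ≤ 1 := by nlinarith
    have h2 : ((P.L : ℝ)⁻¹ * σ) ^ 2 ≤ σ ^ 2 := by
      rw [mul_pow]; exact mul_le_of_le_one_left (sq_nonneg σ) h1
    nlinarith
  exact norm_logVec_lift_rel_le_of_arc hj (wt j) hwt X X' (lift j X) (lift j X') (fun b => hlift _ b) (fun b => hlift _ b) ⟨x, μ⟩
    hσ hσ' hσ3 hmd hfine hfine3

/-- ★ **THE NUMERIC EDITION**: `σ ≤ 1∕4` and `2 ≤ L` ⟹ `c_lift ≤ 11∕10`: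
`‖logVec (su2Quat (M^jU ⟨x,μ⟩·(M^jU₀ ⟨x,μ⟩)⁻¹))‖ ≤ (11∕10)·L⁻¹·m` — so `A = (11∕10)²∕L²`, `A·L = 1.21∕L ≤ ½` for every `L ≥ 3`.
[cite: Balaban1985RegularSpaces, (1.29) p.81; Balaban1985Averaging, Prop. 4 (128)-(135) p.37-38] -/
theorem norm_logVec_rawChord_treeComb_le_eleven_tenths (av : ∀ i, Averaging P i SU2) {j : ℕ} (hj : j + 1 ≤ P.m + P.K)
    (wt : (i : ℕ) → PBond P i → PBond P (i + 1) → ℝ) (lift : (i : ℕ) → GaugeField P (i + 1) SU2 → GaugeField P i SU2)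
    (g g₀ : (i : ℕ) → Site P i → SU2) (U U₁ U₀ : GaugeField P 0 SU2)
    (hwt : ∀ b e, wt j b e = if e.dir = b.dir ∧ (b.src b.dir - emb e.src b.dir).val < P.L then
      ∏ ν ∈ Finset.univ.erase b.dir, max 0 (1 - ((rel (emb e.src) b.src ν).natAbs : ℝ) / P.L) else 0)
    (hlift : ∀ (X : GaugeField P (j + 1) SU2) (b : PBond P j), lift j X b = expPoint (∑ e, wt j b e • ((P.L : ℝ)⁻¹ • logVec (su2Quat (X e)))))
    (hT3 : ∀ X : GaugeField P 0 SU2, Averaging.iter av j (GaugeField.gaugeAct (g 0) X) = GaugeField.gaugeAct (g j) (Averaging.iter av j X))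
    (hT3s : ∀ X : GaugeField P 0 SU2, Averaging.iter av (j + 1) (GaugeField.gaugeAct (g 0) X) = GaugeField.gaugeAct (g (j + 1)) (Averaging.iter av (j + 1) X))
    (hT3' : ∀ X : GaugeField P 0 SU2, Averaging.iter av j (GaugeField.gaugeAct (g₀ 0) X) = GaugeField.gaugeAct (g₀ j) (Averaging.iter av j X))
    (hT3s' : ∀ X : GaugeField P 0 SU2, Averaging.iter av (j + 1) (GaugeField.gaugeAct (g₀ 0) X) = GaugeField.gaugeAct (g₀ (j + 1)) (Averaging.iter av (j + 1) X))
    (hU₀ : U₀ = GaugeField.gaugeAct (fun x => (g 0 x)⁻¹ * g₀ 0 x) U₁)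
    (hT4 : ∀ x, axialT (GaugeField.gaugeAct (g j) (Averaging.iter av j U)) (emb (blockOf x)) x =
      axialT (lift j (GaugeField.gaugeAct (g (j + 1)) (Averaging.iter av (j + 1) U))) (emb (blockOf x)) x)
    (hT4' : ∀ x, axialT (GaugeField.gaugeAct (g₀ j) (Averaging.iter av j U₁)) (emb (blockOf x)) x =
      axialT (lift j (GaugeField.gaugeAct (g₀ (j + 1)) (Averaging.iter av (j + 1) U₁))) (emb (blockOf x)) x)
    (x : Site P j) (μ : Fin P.d) (hblk : blockOf (x.shift μ) = blockOf x) (hlo : ∀ ν, ν < μ → rel (emb (blockOf x)) x ν = 0)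
    {σ m : ℝ} (hL2 : 2 ≤ P.L) (hσ4 : σ ≤ 1 / 4)
    (hσ : ∀ e, wt j ⟨x, μ⟩ e ≠ 0 → ‖logVec (su2Quat (GaugeField.gaugeAct (g (j + 1)) (Averaging.iter av (j + 1) U) e))‖ ≤ σ)
    (hσ' : ∀ e, wt j ⟨x, μ⟩ e ≠ 0 → ‖logVec (su2Quat (GaugeField.gaugeAct (g₀ (j + 1)) (Averaging.iter av (j + 1) U₁) e))‖ ≤ σ)
    (hm : ∀ e, wt j ⟨x, μ⟩ e ≠ 0 → ‖logVec (su2Quat (Averaging.iter av (j + 1) U e * (Averaging.iter av (j + 1) U₀ e)⁻¹))‖ ≤ m) :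
    ‖logVec (su2Quat (Averaging.iter av j U ⟨x, μ⟩ * (Averaging.iter av j U₀ ⟨x, μ⟩)⁻¹))‖ ≤ 11 / 10 * ((P.L : ℝ)⁻¹ * m) := by
  -- `m` is nonnegative as soon as the support is nonempty; if the support is empty the left side vanishes anyway — route through `max m 0`
  have hL0 : 0 ≤ (P.L : ℝ)⁻¹ := inv_nonneg.mpr (Nat.cast_nonneg _)
  have hLhalf : (P.L : ℝ)⁻¹ ≤ 1 / 2 := by
    have h2 : (2 : ℝ) ≤ (P.L : ℝ) := by exact_mod_cast hL2
    rw [inv_le_comm₀ (by linarith) (by norm_num)]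
    linarith
  -- nonnegativity of `σ` needs one feeder; without feeders the lifted chord is `1` — route through `σ₊ := max σ 0`
  have hσp : ∀ e, wt j ⟨x, μ⟩ e ≠ 0 → ‖logVec (su2Quat (GaugeField.gaugeAct (g (j + 1)) (Averaging.iter av (j + 1) U) e))‖ ≤ max σ 0 :=
    fun e he => (hσ e he).trans (le_max_left _ _)
  have hσp' : ∀ e, wt j ⟨x, μ⟩ e ≠ 0 → ‖logVec (su2Quat (GaugeField.gaugeAct (g₀ (j + 1)) (Averaging.iter av (j + 1) U₁) e))‖ ≤ max σ 0 :=
    fun e he => (hσ' e he).trans (le_max_left _ _)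
  have hmp : ∀ e, wt j ⟨x, μ⟩ e ≠ 0 → ‖logVec (su2Quat (Averaging.iter av (j + 1) U e * (Averaging.iter av (j + 1) U₀ e)⁻¹))‖ ≤ max m 0 :=
    fun e he => (hm e he).trans (le_max_left _ _)
  have hs0 : 0 ≤ max σ 0 := le_max_right _ _
  have hs4 : max σ 0 ≤ 1 / 4 := max_le hσ4 (by norm_num)
  have hs34 : (max σ 0) ^ 2 ≤ 3 / 4 := by nlinarith
  have h := norm_logVec_rawChord_treeComb_le_sharp av hj wt lift g g₀ U U₁ U₀ hwt hlift hT3 hT3s hT3' hT3s' hU₀ hT4 hT4' x μ hblk hlo hσp hσp' hs34 hmp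
  -- the constant: `(1 + (2L⁻¹σ₊)²/3)(1 + σ₊²/3) ≤ (1 + 1/48)(1 + 1/48) ≤ 11/10`
  have hc1 : (2 * ((P.L : ℝ)⁻¹ * max σ 0)) ^ 2 / 3 ≤ 1 / 48 := by
    have h1 : 2 * ((P.L : ℝ)⁻¹ * max σ 0) ≤ 1 / 4 := by nlinarith
    have h2 : 0 ≤ 2 * ((P.L : ℝ)⁻¹ * max σ 0) := by positivity
    nlinarith
  have hc2 : (max σ 0) ^ 2 / 3 ≤ 1 / 48 := by nlinarith
  have hc : (1 + (2 * ((P.L : ℝ)⁻¹ * max σ 0)) ^ 2 / 3) * (1 + (max σ 0) ^ 2 / 3) ≤ 11 / 10 := by nlinarith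
  by_cases hm0' : 0 ≤ m
  · have hmm : max m 0 = m := max_eq_left hm0'
    rw [hmm] at h
    calc ‖logVec (su2Quat (Averaging.iter av j U ⟨x, μ⟩ * (Averaging.iter av j U₀ ⟨x, μ⟩)⁻¹))‖
        ≤ (1 + (2 * ((P.L : ℝ)⁻¹ * max σ 0)) ^ 2 / 3) * ((1 + (max σ 0) ^ 2 / 3) * ((P.L : ℝ)⁻¹ * m)) := h
      _ = ((1 + (2 * ((P.L : ℝ)⁻¹ * max σ 0)) ^ 2 / 3) * (1 + (max σ 0) ^ 2 / 3)) * ((P.L : ℝ)⁻¹ * m) := by ring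
      _ ≤ 11 / 10 * ((P.L : ℝ)⁻¹ * m) := mul_le_mul_of_nonneg_right hc (mul_nonneg hL0 hm0')
  · -- a negative `m` is impossible: the hat support of a fine bond is never empty (✓`sum_hatW_eq_one`), and on a feeder `hm` bounds a norm by `m`
    exfalso
    have hzero : ∀ e, wt j ⟨x, μ⟩ e = 0 := fun e => by
      by_contra he
      exact hm0' ((norm_nonneg _).trans (hm e he))
    have h1 := FluctuationComparisonRegPrIntLS2BetaWhitneyHatWeights.sum_hatW_eq_one hj (wt j) hwt ⟨x, μ⟩
    rw [Finset.sum_eq_zero (fun e _ => hzero e)] at h1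
    exact zero_ne_one h1

end CombRow

/-! ## §3 The truncated Pi-sup forms: a per-bond row over nested supports gives the row of the truncated sup norms; the comb∕non-comb split -/

section PiSup

variable {α β E : Type*} [Fintype α] [Fintype β] [NormedAddCommGroup E]

/-- ★★ **ROW OF THE TRUNCATED SUP NORMS**: if every `pS`-bond `b` obeys `‖f b‖ ≤ c·m` whenever `‖f′ e‖ ≤ m` on its feeders, and all feeders of `pS`-bonds satisfy `pT`,
then `‖𝟙_{pS}·f‖_∞ ≤ c·‖𝟙_{pT}·f′‖_∞` (`0 ≤ c`). [folklore] -/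
theorem pi_norm_trunc_le_of_row (pS : α → Prop) [DecidablePred pS] (pT : β → Prop) [DecidablePred pT] (feeds : α → β → Prop)
    (f : α → E) (f' : β → E) {c : ℝ} (hc : 0 ≤ c)
    (hrow : ∀ b, pS b → ∀ m : ℝ, (∀ e, feeds b e → ‖f' e‖ ≤ m) → ‖f b‖ ≤ c * m)
    (hfeed : ∀ b, pS b → ∀ e, feeds b e → pT e) :
    ‖(fun b => if pS b then f b else 0)‖ ≤ c * ‖(fun e => if pT e then f' e else 0)‖ := by
  refine (pi_norm_le_iff_of_nonneg (mul_nonneg hc (norm_nonneg _))).2 fun b => ?_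
  by_cases hb : pS b
  · rw [if_pos hb]
    refine hrow b hb _ fun e he => ?_
    have h1 : ‖(fun e => if pT e then f' e else 0) e‖ ≤ ‖(fun e => if pT e then f' e else 0)‖ :=
      norm_le_pi_norm (fun e => if pT e then f' e else 0) e
    simpa only [if_pos (hfeed b hb e he)] using h1
  · rw [if_neg hb, norm_zero]
    exact mul_nonneg hc (norm_nonneg _)

/-- ★ **THE SQUARED ROW**: under the same hypotheses `‖𝟙_{pS}·f‖² ≤ c²·‖𝟙_{pT}·f′‖²`. [folklore] -/
theorem sq_pi_norm_trunc_le_of_row (pS : α → Prop) [DecidablePred pS] (pT : β → Prop) [DecidablePred pT] (feeds : α → β → Prop)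
    (f : α → E) (f' : β → E) {c : ℝ} (hc : 0 ≤ c)
    (hrow : ∀ b, pS b → ∀ m : ℝ, (∀ e, feeds b e → ‖f' e‖ ≤ m) → ‖f b‖ ≤ c * m)
    (hfeed : ∀ b, pS b → ∀ e, feeds b e → pT e) :
    ‖(fun b => if pS b then f b else 0)‖ ^ 2 ≤ c ^ 2 * ‖(fun e => if pT e then f' e else 0)‖ ^ 2 := by
  have h := pi_norm_trunc_le_of_row pS pT feeds f f' hc hrow hfeed
  rw [← mul_pow]
  exact pow_le_pow_left₀ (norm_nonneg _) h 2

/-- ★ **THE COMB ∕ NON-COMB SPLIT OF A TRUNCATED SUP NORM**: `‖𝟙_p·f‖² ≤ ‖𝟙_{p∧q}·f‖² + ‖𝟙_{p∧¬q}·f‖²`. [folklore] -/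
theorem sq_pi_norm_trunc_le_add (p q : α → Prop) [DecidablePred p] [DecidablePred q] (f : α → E) :
    ‖(fun b => if p b then f b else 0)‖ ^ 2 ≤
      ‖(fun b => if p b ∧ q b then f b else 0)‖ ^ 2 + ‖(fun b => if p b ∧ ¬q b then f b else 0)‖ ^ 2 := by
  set A := ‖(fun b => if p b ∧ q b then f b else 0)‖ with hA
  set B := ‖(fun b => if p b ∧ ¬q b then f b else 0)‖ with hB
  have hA0 : 0 ≤ A := norm_nonneg _
  have hB0 : 0 ≤ B := norm_nonneg _
  have hle : ‖(fun b => if p b then f b else 0)‖ ≤ max A B := by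
    refine (pi_norm_le_iff_of_nonneg (le_max_of_le_left hA0)).2 fun b => ?_
    by_cases hp : p b
    · by_cases hq : q b
      · have h1 : ‖(fun b => if p b ∧ q b then f b else 0) b‖ ≤ A := norm_le_pi_norm (fun b => if p b ∧ q b then f b else 0) b
        simp only [if_pos hp, if_pos (And.intro hp hq)] at h1 ⊢
        exact h1.trans (le_max_left _ _)
      · have h1 : ‖(fun b => if p b ∧ ¬q b then f b else 0) b‖ ≤ B := norm_le_pi_norm (fun b => if p b ∧ ¬q b then f b else 0) b
        simp only [if_pos hp, if_pos (And.intro hp hq)] at h1 ⊢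
        exact h1.trans (le_max_right _ _)
    · simp only [if_neg hp, norm_zero]
      exact le_max_of_le_left hA0
  have hmax : (max A B) ^ 2 ≤ A ^ 2 + B ^ 2 := by
    rcases le_total A B with h | h
    · rw [max_eq_right h]; nlinarith
    · rw [max_eq_left h]; nlinarith
  exact (pow_le_pow_left₀ (norm_nonneg _) hle 2).trans hmax

end PiSup

end Summit.QuantumFields.YangMills.Theorems.FluctuationComparisonRegPrIntLS2BetaLiftLadderCombRow
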